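import Summits.CriticalPhenomena.Ising3DConformalLimit.Theorems.PerfectScreeningGaussianLimitNotScreenedMarkovSquareMixing
import HarnessLib

/-!
# Crux `GaussianLimitNotScreened` (stmt-CriticalPhenomena-13886, route PerfectScreening r4), line
# `single-layer-linear-regression`: stub M1 `stub_markovSquare`, the finite-volume MARKOV SQUARE IDENTITY
# (file 2/2 — THEOREM-ONLY)

For the critical plus measure `μ_L` of `[-L,L]³` (tree `isingMeasure`, `boxMeasure L`), the deep spin
`σ_x`, `x = (n,0,0)`, its mirror image `σ_{θx}`, `θx = (−n,0,0)`, and the regression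
`m_L = E_L[σ_x | layer]` (Mathlib `condExp` w.r.t. the cylinder σ-algebra `layerEvents` of the plane
`{x₀ = 0}`):

  `E_L[m_L²] = E_L[σ_x σ_{θx}]`   for every `n` and EVERY `L` (`integral_regression_sq`),

the registered stub being its `∀ᶠ L` form. Proof:

* §A (pure algebra of finite sums) for positive weights `w` on a finite type fibred by `key`, the FIBRE
  AVERAGE `τ ↦ (Σ_{key τ' = key τ} w τ' a τ') / (Σ_{key τ' = key τ} w τ')` reproduces `a` against
  fibre-constant test functions (`sum_fiberAverage_mul`), and — given a fibre-preserving, weight-preserving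
  involution `Θ` with `b ∘ Θ = a` (MIRROR) and a fibrewise exchange `mix` under which the weights of a pair
  factorise (MARKOV) — its mean square is `Σ w a b` (`sum_fiberAverage_sq`: expand the square, average one
  factor, mirror it into `b`, and exchange lower halves of the pairs in a common fibre);
* §B the explicit `layerEvents`-measurable version `g` of `m_L`: the Boltzmann fibre average of `σ_x` over
  the finite configurations with given layer spins; layer events are determined by the layer spins, so
  the Boltzmann sums of `1_s g` and `1_s σ_x` agree (`exists_layerVersion`, with §A and the Markov/mirror
  structure `stub_markovSquareMixing` of file 1/2);
* §C `g = m_L` a.e. (`ae_eq_condExp_of_forall_setIntegral_eq`; all integrals are finite Boltzmann sums by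
  `integral_isingMeasure`), hence `E_L[m_L²] = E_L[g²] = E_L[σ_x σ_{θx}]`.

References: J. Glimm, A. Jaffe, *Quantum Physics* (2nd ed., 1987), §6.1, Remark "Transfer matrix of
statistical physics", pp. 89–90 [GlimmJaffe1987]; S. Friedli, Y. Velenik, *Statistical Mechanics of
Lattice Systems* (2017), §3.1 [FriedliVelenik2017].
-/

noncomputable section

namespace Summit.CriticalPhenomena.Ising3DConformalLimit.Cruxes.GaussianLimitNotScreened.SingleLayerLinearRegression

open MeasureTheory Filter Topology
open Literature.Probability.LatticeModels

/-! ### §A. Fibre averages of positive weights on a finite type -/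

section FibreSums

open Finset

variable {T K : Type*} [Fintype T] [DecidableEq K]

/-- The total weight of a fibre through one of its points is positive. [folklore] -/
theorem fiberWeight_pos (key : T → K) (w : T → ℝ) (hw : ∀ τ, 0 < w τ) (τ : T) :
    0 < ∑ τ' ∈ univ.filter (fun τ' => key τ' = key τ), w τ' := by
  have hmem : τ ∈ univ.filter (fun τ' => key τ' = key τ) := by simp
  exact lt_of_lt_of_le (hw τ) (single_le_sum (f := w) (fun τ' _ => (hw τ').le) hmem)

/-- **Fibre averaging** (the finite conditional expectation): against a fibre-constant test function
`ψ`, the weighted sum of the fibre average of `a` is the weighted sum of `a`. [folklore] -/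
theorem sum_fiberAverage_mul (key : T → K) (w a ψ : T → ℝ) (hw : ∀ τ, 0 < w τ)
    (hψ : ∀ τ τ', key τ' = key τ → ψ τ' = ψ τ) :
    ∑ τ, w τ * (ψ τ * ((∑ τ' ∈ univ.filter (fun τ' => key τ' = key τ), w τ' * a τ') /
        ∑ τ' ∈ univ.filter (fun τ' => key τ' = key τ), w τ')) = ∑ τ, w τ * (ψ τ * a τ) := by
  set B : T → ℝ := fun τ => ∑ τ' ∈ univ.filter (fun τ' => key τ' = key τ), w τ' with hB
  have hBpos : ∀ τ, 0 < B τ := fiberWeight_pos key w hw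
  have hBeq : ∀ τ τ', key τ' = key τ → B τ' = B τ := fun τ τ' h => by simp only [hB, h]
  calc ∑ τ, w τ * (ψ τ * ((∑ τ' ∈ univ.filter (fun τ' => key τ' = key τ), w τ' * a τ') / B τ))
      = ∑ τ, ∑ τ' ∈ univ.filter (fun τ' => key τ' = key τ), w τ * ψ τ * w τ' * a τ' / B τ := by
        refine sum_congr rfl fun τ _ => ?_
        rw [sum_div, mul_sum, mul_sum]
        exact sum_congr rfl fun τ' _ => by ring
    _ = ∑ τ', ∑ τ ∈ univ.filter (fun τ => key τ = key τ'), w τ * ψ τ * w τ' * a τ' / B τ := by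
        refine sum_comm' fun τ τ' => ?_
        simp only [mem_filter, mem_univ, true_and, and_true]
        exact eq_comm
    _ = ∑ τ', w τ' * (ψ τ' * a τ') := by
        refine sum_congr rfl fun τ' _ => ?_
        calc ∑ τ ∈ univ.filter (fun τ => key τ = key τ'), w τ * ψ τ * w τ' * a τ' / B τ
            = ∑ τ ∈ univ.filter (fun τ => key τ = key τ'), w τ * (ψ τ' * w τ' * a τ' / B τ') := by
              refine sum_congr rfl fun τ hτ => ?_
              have h : key τ = key τ' := (mem_filter.1 hτ).2
              rw [hψ τ' τ h, hBeq τ' τ h]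
              ring
          _ = B τ' * (ψ τ' * w τ' * a τ' / B τ') := by rw [← sum_mul]
          _ = w τ' * (ψ τ' * a τ') := by
              have hB0 : B τ' ≠ 0 := (hBpos τ').ne'
              field_simp

/-- **Mean square of a fibre average under a Markov–mirror structure.** If a fibre-preserving,
weight-preserving involution `Θ` turns `b` into `a`, and a fibrewise exchange `mix` makes the weights of
a pair in a common fibre factorise, keeps `a` from the first and takes `b` from the second argument, then
`Σ_τ w τ · (fibre average of a at τ)² = Σ_τ w τ · a τ · b τ`. (Expand the square; average one factor by
`sum_fiberAverage_mul`; mirror it into a fibre sum of `w b`; exchange the lower halves of the pairs of a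
common fibre.) [cite: GlimmJaffe1987, §6.1 Remark 'Transfer matrix of statistical physics', pp. 89–90] -/
theorem sum_fiberAverage_sq (key : T → K) (w a b : T → ℝ) (Θ : T → T) (mix : T → T → T)
    (hw : ∀ τ, 0 < w τ)
    (hΘk : ∀ τ, key (Θ τ) = key τ) (hΘΘ : ∀ τ, Θ (Θ τ) = τ) (hΘw : ∀ τ, w (Θ τ) = w τ)
    (hΘb : ∀ τ, b (Θ τ) = a τ)
    (hMk : ∀ τ τ', key τ' = key τ → key (mix τ τ') = key τ)
    (hMM : ∀ τ τ', key τ' = key τ → mix (mix τ τ') (mix τ' τ) = τ)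
    (hMw : ∀ τ τ', key τ' = key τ → w (mix τ τ') * w (mix τ' τ) = w τ * w τ')
    (hMa : ∀ τ τ', key τ' = key τ → a (mix τ τ') = a τ)
    (hMb : ∀ τ τ', key τ' = key τ → b (mix τ τ') = b τ') :
    ∑ τ, w τ * ((∑ τ' ∈ univ.filter (fun τ' => key τ' = key τ), w τ' * a τ') /
        ∑ τ' ∈ univ.filter (fun τ' => key τ' = key τ), w τ') ^ 2 = ∑ τ, w τ * (a τ * b τ) := by
  set A : T → ℝ := fun τ => ∑ τ' ∈ univ.filter (fun τ' => key τ' = key τ), w τ' * a τ' with hA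
  set B : T → ℝ := fun τ => ∑ τ' ∈ univ.filter (fun τ' => key τ' = key τ), w τ' with hB
  have hBpos : ∀ τ, 0 < B τ := fiberWeight_pos key w hw
  have hAeq : ∀ τ τ', key τ' = key τ → A τ' = A τ := fun τ τ' h => by simp only [hA, h]
  have hBeq : ∀ τ τ', key τ' = key τ → B τ' = B τ := fun τ τ' h => by simp only [hB, h]
  -- the pairs lying in a common fibre, and the Markov involution on them
  set R : Finset (T × T) := univ.filter (fun p : T × T => key p.2 = key p.1) with hR
  have hRmem : ∀ p : T × T, p ∈ R ↔ p.1 ∈ univ ∧ p.2 ∈ univ.filter (fun τ' => key τ' = key p.1) := by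
    intro p
    simp [hR]
  have hM : ∀ p ∈ R, (mix p.1 p.2, mix p.2 p.1) ∈ R := by
    intro p hp
    have h : key p.2 = key p.1 := (mem_filter.1 hp).2
    refine mem_filter.2 ⟨mem_univ _, ?_⟩
    rw [hMk p.1 p.2 h, hMk p.2 p.1 h.symm, h]
  have hMM' : ∀ p ∈ R, (mix (mix p.1 p.2, mix p.2 p.1).1 (mix p.1 p.2, mix p.2 p.1).2,
      mix (mix p.1 p.2, mix p.2 p.1).2 (mix p.1 p.2, mix p.2 p.1).1) = p := by
    intro p hp
    have h : key p.2 = key p.1 := (mem_filter.1 hp).2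
    exact Prod.ext (hMM p.1 p.2 h) (hMM p.2 p.1 h.symm)
  -- (1) one factor of the square becomes `a` (fibre averaging with the fibre-constant `ψ = A / B`)
  have h1 : ∑ τ, w τ * (A τ / B τ) ^ 2 = ∑ τ, w τ * (A τ / B τ * a τ) := by
    have := sum_fiberAverage_mul key w a (fun τ => A τ / B τ) hw
      (fun τ τ' h => by simp only [hAeq τ τ' h, hBeq τ τ' h])
    simp only [sq]
    simpa only [mul_comm, mul_assoc, mul_left_comm] using this
  -- (2) mirror: the fibre sum of `w a` is the fibre sum of `w b`
  have h2 : ∀ τ, A τ = ∑ τ' ∈ univ.filter (fun τ' => key τ' = key τ), w τ' * b τ' := by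
    intro τ
    refine sum_nbij' Θ Θ (fun τ' hτ' => ?_) (fun τ' hτ' => ?_) (fun τ' _ => hΘΘ τ')
      (fun τ' _ => hΘΘ τ') (fun τ' _ => by rw [hΘw, hΘb])
    · simp only [mem_filter, mem_univ, true_and] at hτ' ⊢
      rw [hΘk, hτ']
    · simp only [mem_filter, mem_univ, true_and] at hτ' ⊢
      rw [hΘk, hτ']
  -- (3) Markov: exchange the lower halves of the pairs of a common fibre
  calc ∑ τ, w τ * (A τ / B τ) ^ 2
      = ∑ τ, w τ * (A τ / B τ * a τ) := h1
    _ = ∑ τ, ∑ τ' ∈ univ.filter (fun τ' => key τ' = key τ),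
          w τ * a τ * w τ' * b τ' / B τ := by
        refine sum_congr rfl fun τ _ => ?_
        rw [h2 τ, sum_div, sum_mul, mul_sum]
        exact sum_congr rfl fun τ' _ => by ring
    _ = ∑ p ∈ R, w p.1 * a p.1 * w p.2 * b p.2 / B p.1 := (sum_finset_product' R univ _ hRmem).symm
    _ = ∑ p ∈ R, w p.1 * a p.1 * b p.1 * w p.2 / B p.1 := by
        refine sum_nbij' (fun p => (mix p.1 p.2, mix p.2 p.1)) (fun p => (mix p.1 p.2, mix p.2 p.1))
          hM hM hMM' hMM' fun p hp => ?_
        have h : key p.2 = key p.1 := (mem_filter.1 hp).2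
        simp only
        rw [hMa _ _ h, hMb _ _ h, hBeq p.1 _ (hMk _ _ h),
          show w (mix p.1 p.2) * a p.1 * b p.2 * w (mix p.2 p.1) =
            w (mix p.1 p.2) * w (mix p.2 p.1) * (a p.1 * b p.2) by ring, hMw _ _ h]
        ring
    _ = ∑ τ, ∑ τ' ∈ univ.filter (fun τ' => key τ' = key τ),
          w τ * a τ * b τ * w τ' / B τ :=
        sum_finset_product' R univ _ hRmem (f := fun τ τ' => w τ * a τ * b τ * w τ' / B τ)
    _ = ∑ τ, w τ * (a τ * b τ) := by
        refine sum_congr rfl fun τ _ => ?_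
        rw [← sum_div, ← mul_sum]
        change w τ * a τ * b τ * B τ / B τ = _
        have hB0 : B τ ≠ 0 := (hBpos τ).ne'
        field_simp

end FibreSums

/-! ### §B. The explicit layer version of the deep-spin regression -/

/-- **The explicit `layerEvents`-measurable version of `E_L[σ_{(n,0,0)} | layer]` and its two Boltzmann-sum
identities.** There is a bounded `layerEvents`-measurable `g` (the Boltzmann fibre average of the deep
spin over the finite configurations of `[-L,L]³` with given layer spins) such that (i) the Boltzmann sums
of `1_s · g` and `1_s · σ_{(n,0,0)}` agree for every layer event `s` (a layer event is determined by the
layer spins), and (ii) the Boltzmann sum of `g²` is that of `σ_{(n,0,0)} σ_{(−n,0,0)}` (§A with the Markov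
and mirror structure `stub_markovSquareMixing`).
[cite: GlimmJaffe1987, §6.1 Remark 'Transfer matrix of statistical physics', pp. 89–90] -/
theorem exists_layerVersion (n L : ℕ) (β h : ℝ) :
    ∃ g : SpinConfig (Site 3) → ℝ,
      Measurable[layerEvents] g ∧ (∃ C : ℝ, ∀ σ, |g σ| ≤ C) ∧
      (∀ s : Set (SpinConfig (Site 3)), MeasurableSet[layerEvents] s →
        ∑ τ : ↥(box 3 L) → ℤˣ, isingWeight (zdGraph 3) (box 3 L) β h BoundaryCondition.plus τ *
            s.indicator g (glue (box 3 L) τ BoundaryCondition.plus) =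
          ∑ τ : ↥(box 3 L) → ℤˣ, isingWeight (zdGraph 3) (box 3 L) β h BoundaryCondition.plus τ *
            s.indicator (spinAt (deepSite n)) (glue (box 3 L) τ BoundaryCondition.plus)) ∧
      ∑ τ : ↥(box 3 L) → ℤˣ, isingWeight (zdGraph 3) (box 3 L) β h BoundaryCondition.plus τ *
          g (glue (box 3 L) τ BoundaryCondition.plus) ^ 2 =
        ∑ τ : ↥(box 3 L) → ℤˣ, isingWeight (zdGraph 3) (box 3 L) β h BoundaryCondition.plus τ *
          spinPair (deepSite n) (Fin.cons (-(n : ℤ)) 0) (glue (box 3 L) τ BoundaryCondition.plus) := by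
  classical
  set W : (↥(box 3 L) → ℤˣ) → ℝ := isingWeight (zdGraph 3) (box 3 L) β h BoundaryCondition.plus
    with hW
  -- layer keys of finite / infinite configurations, the two spins, the fibre average
  let key : (↥(box 3 L) → ℤˣ) → ({y : ↥(box 3 L) // (y : Site 3) 0 = 0} → ℤˣ) := fun τ y => τ y.1
  let lkey : SpinConfig (Site 3) → ({y : ↥(box 3 L) // (y : Site 3) 0 = 0} → ℤˣ) :=
    fun σ y => σ y.1.1
  let a : (↥(box 3 L) → ℤˣ) → ℝ := fun τ => spinAt (deepSite n) (glue (box 3 L) τ BoundaryCondition.plus)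
  let b : (↥(box 3 L) → ℤˣ) → ℝ := fun τ =>
    spinAt (Fin.cons (-(n : ℤ)) 0 : Site 3) (glue (box 3 L) τ BoundaryCondition.plus)
  let G : ({y : ↥(box 3 L) // (y : Site 3) 0 = 0} → ℤˣ) → ℝ := fun k =>
    (∑ τ' ∈ Finset.univ.filter (fun τ' => key τ' = k), W τ' * a τ') /
      ∑ τ' ∈ Finset.univ.filter (fun τ' => key τ' = k), W τ'
  have hlk : ∀ τ, lkey (glue (box 3 L) τ BoundaryCondition.plus) = key τ := fun τ => funext fun y => by
    simp only [lkey, key, glue_apply_of_mem _ _ _ y.1.2, Subtype.coe_eta]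
  -- key equality, pointwise (the form used by file 1/2)
  have hkey : ∀ τ τ' : ↥(box 3 L) → ℤˣ, key τ' = key τ →
      ∀ y : ↥(box 3 L), (y : Site 3) 0 = 0 → τ' y = τ y := fun τ τ' hk y hy => congrFun hk ⟨y, hy⟩
  refine ⟨fun σ => G (lkey σ), ?_, ?_, ?_, ?_⟩
  · -- `g` factors through the (finitely many) layer spins of the box
    have hl : Measurable[layerEvents] lkey :=
      (@measurable_pi_iff _ _ _ layerEvents _ lkey).2 fun y =>
        measurable_cylinderEvent_apply (i := y.1.1) y.2
    exact (measurable_of_finite G).comp hl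
  · exact ⟨∑ k, |G k|, fun σ =>
      Finset.single_le_sum (f := fun k => |G k|) (fun k _ => abs_nonneg (G k)) (Finset.mem_univ (lkey σ))⟩
  · intro s hs
    -- a layer event is determined by the layer spins
    have hle : layerEvents ≤ MeasurableSpace.comap (Set.restrict {y : Site 3 | y 0 = 0}) ⊤ := by
      dsimp only [layerEvents, cylinderEvents]
      refine iSup₂_le fun i hi => ?_
      rw [show (fun σ : SpinConfig (Site 3) => σ i) =
          (fun f : ({y : Site 3 | y 0 = 0} → ℤˣ) => f ⟨i, hi⟩) ∘ Set.restrict {y : Site 3 | y 0 = 0}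
          from rfl, ← MeasurableSpace.comap_comp]
      exact MeasurableSpace.comap_mono le_top
    obtain ⟨t, -, hts⟩ := MeasurableSpace.measurableSet_comap.1 (hle s hs)
    have hdet : ∀ τ τ' : ↥(box 3 L) → ℤˣ, key τ' = key τ →
        (glue (box 3 L) τ' BoundaryCondition.plus ∈ s ↔ glue (box 3 L) τ BoundaryCondition.plus ∈ s) := by
      intro τ τ' hk
      rw [← hts, Set.mem_preimage, Set.mem_preimage]
      suffices hr : Set.restrict {y : Site 3 | y 0 = 0} (glue (box 3 L) τ' BoundaryCondition.plus) =
          Set.restrict {y : Site 3 | y 0 = 0} (glue (box 3 L) τ BoundaryCondition.plus) by rw [hr]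
      funext y
      exact (glue_eq_of_layer_eq (hkey τ τ' hk) y.2).symm
    have hind : ∀ (f : SpinConfig (Site 3) → ℝ) (τ : ↥(box 3 L) → ℤˣ),
        s.indicator f (glue (box 3 L) τ BoundaryCondition.plus) =
          (if glue (box 3 L) τ BoundaryCondition.plus ∈ s then (1 : ℝ) else 0) *
            f (glue (box 3 L) τ BoundaryCondition.plus) := fun f τ => by
      simp only [Set.indicator_apply, boole_mul]
    simp_rw [hind]
    simp only [hlk]
    exact sum_fiberAverage_mul key W a
      (fun τ => if glue (box 3 L) τ BoundaryCondition.plus ∈ s then (1 : ℝ) else 0)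
      (isingWeight_pos _ _ _ _ _) (fun τ τ' hk => by simp only [hdet τ τ' hk])
  · obtain ⟨Θ, mix, hΘ, hM⟩ := stub_markovSquareMixing n L β h
    simp only [hlk, spinPair]
    exact sum_fiberAverage_sq key W a b Θ mix (isingWeight_pos _ _ _ _ _)
      (fun τ => funext fun y => (hΘ τ).1 y.1 y.2) (fun τ => (hΘ τ).2.1) (fun τ => (hΘ τ).2.2.1)
      (fun τ => (hΘ τ).2.2.2)
      (fun τ τ' hk => funext fun y => (hM τ τ' (hkey τ τ' hk)).1 y.1 y.2)
      (fun τ τ' hk => (hM τ τ' (hkey τ τ' hk)).2.1) (fun τ τ' hk => (hM τ τ' (hkey τ τ' hk)).2.2.1)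
      (fun τ τ' hk => (hM τ τ' (hkey τ τ' hk)).2.2.2.1)
      (fun τ τ' hk => (hM τ τ' (hkey τ τ' hk)).2.2.2.2)

/-! ### §C. The Markov square identity -/

/-- **The finite-volume Markov square identity, for every box.**
`E_L[(E_L[σ_{(n,0,0)} | layer])²] = E_L[σ_{(n,0,0)} σ_{(−n,0,0)}]` for the critical plus measure of
`[-L,L]³`: the explicit layer version `g` of `exists_layerVersion` is a version of the conditional
expectation (`ae_eq_condExp_of_forall_setIntegral_eq`, the set integrals being finite Boltzmann sums by
`integral_isingMeasure`), and its mean square is the Boltzmann sum of `σ_{(n,0,0)} σ_{(−n,0,0)}`.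
[cite: GlimmJaffe1987, §6.1 Remark 'Transfer matrix of statistical physics', pp. 89–90] -/
theorem integral_regression_sq (n L : ℕ) :
    ∫ σ, regression n L σ ^ 2 ∂(boxMeasure L) =
      isingExpect (zdGraph 3) (box 3 L) (criticalBeta 3) 0 BoundaryCondition.plus
        (spinPair (deepSite n) (Fin.cons (-(n : ℤ)) 0)) := by
  obtain ⟨g, hgm, ⟨C, hC⟩, hset, hsq⟩ := exists_layerVersion n L (criticalBeta 3) 0
  have hle : layerEvents ≤ (MeasurableSpace.pi : MeasurableSpace (SpinConfig (Site 3))) :=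
    cylinderEvents_le_pi
  have hgm' : Measurable g := hgm.mono hle le_rfl
  haveI : IsProbabilityMeasure (boxMeasure L) := by
    unfold boxMeasure; infer_instance
  have hgi : Integrable g (boxMeasure L) :=
    Integrable.of_bound hgm'.aestronglyMeasurable C
      (Eventually.of_forall fun σ => by rw [Real.norm_eq_abs]; exact hC σ)
  have hfi : Integrable (spinAt (deepSite n)) (boxMeasure L) :=
    Integrable.of_bound (measurable_spinAt _).aestronglyMeasurable 1
      (Eventually.of_forall fun σ => by rw [Real.norm_eq_abs, abs_spinAt])
  have hae : g =ᵐ[boxMeasure L] regression n L := by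
    unfold regression
    refine ae_eq_condExp_of_forall_setIntegral_eq hle hfi (fun s _ _ => hgi.integrableOn)
      (fun s hs _ => ?_) hgm.stronglyMeasurable.aestronglyMeasurable
    have hs' : MeasurableSet s := hle s hs
    rw [← integral_indicator hs', ← integral_indicator hs']
    simp only [boxMeasure]
    rw [integral_isingMeasure (zdGraph 3) (box 3 L) (criticalBeta 3) 0 _ (hgm'.indicator hs'),
      integral_isingMeasure (zdGraph 3) (box 3 L) (criticalBeta 3) 0 _
        ((measurable_spinAt _).indicator hs'), hset s hs]
  calc ∫ σ, regression n L σ ^ 2 ∂(boxMeasure L)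
      = ∫ σ, g σ ^ 2 ∂(boxMeasure L) :=
        integral_congr_ae (hae.symm.fun_comp fun x : ℝ => x ^ 2)
    _ = (∑ τ : ↥(box 3 L) → ℤˣ,
            isingWeight (zdGraph 3) (box 3 L) (criticalBeta 3) 0 BoundaryCondition.plus τ *
              g (glue (box 3 L) τ BoundaryCondition.plus) ^ 2) /
          isingPartitionFunction (zdGraph 3) (box 3 L) (criticalBeta 3) 0 BoundaryCondition.plus := by
        simp only [boxMeasure]
        exact integral_isingMeasure (zdGraph 3) (box 3 L) (criticalBeta 3) 0 _ (hgm'.pow_const 2)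
    _ = (∑ τ : ↥(box 3 L) → ℤˣ,
            isingWeight (zdGraph 3) (box 3 L) (criticalBeta 3) 0 BoundaryCondition.plus τ *
              spinPair (deepSite n) (Fin.cons (-(n : ℤ)) 0) (glue (box 3 L) τ BoundaryCondition.plus)) /
          isingPartitionFunction (zdGraph 3) (box 3 L) (criticalBeta 3) 0 BoundaryCondition.plus := by
        rw [hsq]
    _ = isingExpect (zdGraph 3) (box 3 L) (criticalBeta 3) 0 BoundaryCondition.plus
          (spinPair (deepSite n) (Fin.cons (-(n : ℤ)) 0)) :=
        (integral_isingMeasure (zdGraph 3) (box 3 L) (criticalBeta 3) 0 _ (measurable_spinPair _ _)).symm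

/-- **Stub M1 `stub_markovSquare` — the MARKOV SQUARE IDENTITY** of the line
`single-layer-linear-regression`: for every depth `n` and all (in particular all large) boxes `L`,
`E_L[(E_L[σ_{(n,0,0)} | layer])²] = E_L[σ_{(n,0,0)} σ_{(−n,0,0)}]` (`integral_regression_sq`), the one
place where the nearest-neighbour Markov (DLR) structure of `isingMeasure (zdGraph 3)` is used.
[cite: GlimmJaffe1987, §6.1 Remark 'Transfer matrix of statistical physics', pp. 89–90] -/
theorem stub_markovSquare :
    ∀ n : ℕ, ∀ᶠ L : ℕ in atTop,
      ∫ σ, regression n L σ ^ 2 ∂(boxMeasure L) =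
        isingExpect (zdGraph 3) (box 3 L) (criticalBeta 3) 0 BoundaryCondition.plus
          (spinPair (deepSite n) (Fin.cons (-(n : ℤ)) 0)) :=
  fun n => Eventually.of_forall fun L => integral_regression_sq n L

end Summit.CriticalPhenomena.Ising3DConformalLimit.Cruxes.GaussianLimitNotScreened.SingleLayerLinearRegression

end
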